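/-
Copyright (c) 2026 the pub-hodgecm-mathlib formalisation cell (harness21).  Prover seat hodgecm-mathlib-F0P3a-p04 (g23), 2026-09-02 (line LH7, O8b census
residual (iii) «archimedean places»: the CM DISCHARGE of the weak-approximation hypothesis `hWA` of ★ `UnitaryGroupFiniteAdelicDenseOrbit`; split
LH7-p04 (g3) 2026-09-02T08:36:59Z).  PROOF module: THEOREMS ONLY (no definition, no named fact, no instance, no notation, no `sorry`).
-/
import Literature.NumberTheory.Automorphic.UnitaryGroupFiniteAdelicDenseOrbit   -- ★ p850540: `dense_finiteAdelic_mul_quotientSubgroup_of_denseRange (hWA)`, `eq_ofChar_of_forall_finAdelicToAdelic_apply_eq_smul (hWA)` …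
import Literature.NumberTheory.Automorphic.UnitaryGroupRealApproximation        -- ★ `denseRange_rationalToArch_cm` (weak approximation at `∞` for `U(H)`, CM field, Cayley's method)
import Literature.NumberTheory.Automorphic.UnitaryGroupArchLatticeJunction      -- ★ `archPart_toAdelic : (γ)_∞ = γ ⊗ 1`
import Literature.NumberTheory.Automorphic.LocalUnitaryGroupCongr               -- ★ `antidiagOne_eq_over`, ★ `isUnit_antidiagOne_det` (Mok's `Φ_N`); ★ `AdelicUnitaryGroupDatum` instances
import HarnessLib

/-!
# `U(H)(𝔸_{L⁺,f}) · U(H)(L⁺)` is dense in `U(H)(𝔸_{L⁺})` for a CM field — the weak-approximation hypothesis of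
# `UnitaryGroupFiniteAdelicDenseOrbit` DISCHARGED, and its `L²` consequences hypothesis-free

Topic `NumberTheory/Automorphic`; namespace `Literature.NumberTheory.Automorphic.UnitaryGroup`.  THEOREMS ONLY.

SETTING.  ★ `UnitaryGroupFiniteAdelicDenseOrbit` proves, for the tree's generic adelic unitary datum ★ `adelicGroupData F E c N J` and UNDER the
hypothesis `hWA : DenseRange fun γ => archPart F E c N J (toAdelic γ)` («`U(J)(F)` is dense in `U(J)(E ⊗ ℝ)`», weak approximation at the
archimedean places), that the finite-adelic subgroup `U(J)(𝔸_{F,f})` (★ `finiteAdelic`, closed and normal) has dense orbit `U(J)(𝔸_{F,f}) · U(J)(F)` in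
`U(J)(𝔸_F)`, hence (★ Moore's lemma, `AutomorphicQuotientSubgroupErgodic`) acts ergodically on `U(J)(F) \ U(J)(𝔸_F)`, so that a discrete automorphic
representation on which `U(J)(𝔸_{F,f})` acts through the scalars of an automorphic character `ψ` IS the line `ofChar ψ μ`.  For a CM field `L`
(`F = L⁺`, `E = L`, `c` = complex conjugation) and a NON-DEGENERATE HERMITIAN `H ∈ M_N(L)` the hypothesis `hWA` is a THEOREM of the tree:
★ `UnitaryGroupRealApproximation :: denseRange_rationalToArch_cm` ([PlatonovRapinchuk1994] §7.1 Thm. 7.7 p. 415 for `G = U(H)`, `S = V_∞`, proved by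
Cayley's method in ★ `GroupTheory/ArithmeticGroups/UnitaryRealApproximationCM{,Dense}`), stated for ★ `rationalToArch` (`γ ↦ γ ⊗ 1`), which is
`γ ↦ (γ)_∞` by ★ `archPart_toAdelic`.  This file performs the substitution once and for all.

CONTENT.
* §1 (generic `F E c J`) `denseRange_archPart_toAdelic_iff` ∕ `denseRange_archPart_toAdelic_of_denseRange_rationalToArch` — the two spellings of
  `hWA` (`archPart ∘ toAdelic` of ★ p850540 vs ★ `rationalToArch`) agree (`funext` ★ `archPart_toAdelic`).
* §2 (CM, `H` hermitian non-degenerate: `hH : (H.map c̄)ᵀ = H`, `hdet : IsUnit H.det`) **`denseRange_archPart_toAdelic_cm`** (= `hWA` DISCHARGED),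
  **`dense_finiteAdelic_mul_arithmeticSubgroup_cm`**, **`dense_finiteAdelic_mul_quotientSubgroup_cm`** — the `hd` binder of ★
  `AdelicGroupData.ergodicSMul_subgroup_automorphicQuotient` for `M := finiteAdelic L⁺ L c̄ N H`, hypothesis-free.
* §3 (CM, `L²`) **`ergodicSMul_finiteAdelic_automorphicQuotient_cm`**, `ae_eq_const_of_forall_rightRegular_finAdelicToAdelic_apply_eq_cm`,
  `mem_lineSubrep_of_forall_rightRegular_finAdelicToAdelic_apply_eq_smul_cm`, **`eq_ofChar_of_forall_finAdelicToAdelic_apply_eq_smul_cm`**,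
  `eq_of_forall_finAdelicToAdelic_apply_eq_smul_cm`, `isOneDimensional_of_forall_finAdelicToAdelic_apply_eq_smul_cm` — ★ p850540 §2 with `hWA`
  discharged AND the `[LocallyCompactSpace]`∕`[SecondCountableTopology]` binders supplied by the tree instances on the (definitionally equal, ★
  `adelicGroupData_eq_cmDatum`) `cmDatum L N H` (★ `locallyCompactSpace_cmDatum_Adelic`, ★ `secondCountableTopology_cmDatum_Adelic`).
* §4 Mok's quasi-split form `Φ_N = antidiag(1, …, 1)` (`Matrix.of fun i j : Fin N => if i.val + j.val + 1 = N then 1 else 0`; hermitian with unit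
  determinant: ★ `antidiagOne_eq_over`, ★ `StdForm.over_map`∕`transpose_over`, ★ `isUnit_antidiagOne_det`): every §2–§3 statement BINDER-FREE
  (`…_antidiagOne`), in particular **`denseRange_archPart_toAdelic_antidiagOne (L N)`** and **`eq_ofChar_of_forall_finAdelicToAdelic_apply_eq_smul_antidiagOne`**
  — at `N = 2` the input of the O8b close on `adelicGroupData L⁺ L c̄ 2 Φ₂`.

CONSUMER (cell `hodgecm-mathlib`, crux H413 = `stmt-HodgeConjecture-24833`, line LH7, print letter O8b `PKmultOneU2Shape` ⟸ (O8b♭) ISOTYPY; `CENSUS-O8b-PKmultOneU2`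
residual (iii)): with ★ `DiscreteAutomorphicRep.toContRep_finAdelicToAdelic_apply_eq_smul_of_forall_inclPlaceAdelic` (`DiscreteAutomorphicRepFinAdelicScalar`, places → `𝔸_f`)
and ★ `F0P3cPKtupleU2LocalIsotypyFull` (per-place isotypy from `Realises₂`), §4 at `N = 2` gives `P₂ = ofChar ((η ψ) ∘ det)⁻¹ μ₂` with NO archimedean
hypothesis.  HONEST LABEL: adelic plumbing over tree theorems, proved; HC_CM is proved only modulo the 7 printed citations of that programme (2 remaining:
hLiu418 = stmt-HodgeConjecture-24832, h413 = stmt-HodgeConjecture-24833) until its rung 0 closes; this file books nothing and discharges nothing booked.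

NOT HERE: the generic statements (★ `UnitaryGroupFiniteAdelicDenseOrbit`); weak approximation itself (★ `UnitaryGroupRealApproximation`); strong
approximation at the finite places ([PlatonovRapinchuk1994] §7.4 — a different theorem); degenerate or non-hermitian `J`.

## References
* [PlatonovRapinchuk1994] V. Platonov, A. Rapinchuk, *Algebraic Groups and Number Theory*, Academic Press (1994), §7.1 Thm. 7.7 p. 415 (real
  approximation «`G(K)` is dense in `G_∞`»), §5.1 (`G(𝔸) = G_∞ × G(𝔸_f)`).
* [Zimmer1984] R. J. Zimmer, *Ergodic Theory and Semisimple Groups*, Birkhäuser (1984), §2.2 Cor. 2.2.3 (Moore's lemma).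
* [Mok2014] C. P. Mok, *Endoscopic classification of representations of quasi-split unitary groups*, Mem. AMS 235 (2015), §1 Notation p. 5 (`Φ_N`).
-/

set_option autoImplicit false

noncomputable section

open MeasureTheory NumberField IsDedekindDomain Topology Filter

open scoped Matrix MatrixGroups Pointwise

namespace Literature.NumberTheory.Automorphic

namespace UnitaryGroup

/-! ## §1 The two spellings of the weak-approximation hypothesis agree -/

section Generic

variable (F E : Type) [Field F] [NumberField F] [Field E] [NumberField E] [Algebra F E]
  (c : E ≃ₐ[F] E) (N : ℕ) (J : Matrix (Fin N) (Fin N) E)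

/-- **`γ ↦ (γ)_∞` IS `γ ↦ γ ⊗ 1`**: the archimedean component of the diagonal adelic image of a rational point is its diagonal archimedean image
(★ `archPart_toAdelic`, as an equality of functions `U(J)(F) → U(J)(E ⊗ ℝ)`). [cite: BorelJacquet1979, §4.1] -/
theorem archPart_comp_toAdelic_eq_rationalToArch :
    (fun γ : (adelicGroupData F E c N J).Rational => archPart F E c N J ((adelicGroupData F E c N J).toAdelic γ)) =
      rationalToArch F E c N J :=
  funext fun γ => archPart_toAdelic F E c N J γ

/-- **The two spellings of weak approximation at `∞` agree**: density of `γ ↦ (γ)_∞` (the `hWA` of ★ `UnitaryGroupFiniteAdelicDenseOrbit`) iff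
density of `γ ↦ γ ⊗ 1` (★ `rationalToArch`, the form proved in ★ `UnitaryGroupRealApproximation`). [cite: PlatonovRapinchuk1994, §7.1 Thm 7.7] -/
theorem denseRange_archPart_toAdelic_iff :
    (DenseRange fun γ : (adelicGroupData F E c N J).Rational => archPart F E c N J ((adelicGroupData F E c N J).toAdelic γ)) ↔
      DenseRange (rationalToArch F E c N J) := by
  refine ⟨fun h => ?_, fun h => ?_⟩
  · rwa [archPart_comp_toAdelic_eq_rationalToArch] at h
  · rw [archPart_comp_toAdelic_eq_rationalToArch]
    exact h

/-- Weak approximation in the ★ `rationalToArch` spelling gives it in the `archPart ∘ toAdelic` spelling. [cite: PlatonovRapinchuk1994, §7.1 Thm 7.7] -/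
theorem denseRange_archPart_toAdelic_of_denseRange_rationalToArch (hWA : DenseRange (rationalToArch F E c N J)) :
    DenseRange fun γ : (adelicGroupData F E c N J).Rational => archPart F E c N J ((adelicGroupData F E c N J).toAdelic γ) :=
  (denseRange_archPart_toAdelic_iff F E c N J).2 hWA

end Generic

/-! ## §2 The CM case: `hWA` discharged, dense orbit hypothesis-free -/

section CM

variable (N : ℕ) (L : Type) [Field L] [NumberField L] [IsCMField L] (H : Matrix (Fin N) (Fin N) L)

/-- **Weak approximation at `∞` for `U(H)` over a CM field, in the `archPart ∘ toAdelic` spelling — the hypothesis `hWA` of ★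
`UnitaryGroupFiniteAdelicDenseOrbit` DISCHARGED**: for a CM field `L` and a non-degenerate hermitian `H ∈ M_N(L)` the map `γ ↦ (γ)_∞ :
U(H)(L⁺) → U(H)(L ⊗ ℝ)` has dense range (★ `denseRange_rationalToArch_cm` ∘ §1). [cite: PlatonovRapinchuk1994, §7.1 Thm 7.7] -/
theorem denseRange_archPart_toAdelic_cm (hH : (H.map (IsCMField.complexConj L))ᵀ = H) (hdet : IsUnit H.det) :
    DenseRange fun γ : (adelicGroupData (↥(maximalRealSubfield L)) L (IsCMField.complexConj L) N H).Rational =>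
      archPart (↥(maximalRealSubfield L)) L (IsCMField.complexConj L) N H
        ((adelicGroupData (↥(maximalRealSubfield L)) L (IsCMField.complexConj L) N H).toAdelic γ) :=
  denseRange_archPart_toAdelic_of_denseRange_rationalToArch _ L _ N H (denseRange_rationalToArch_cm N L H hH hdet)

/-- **`U(H)(𝔸_{L⁺,f}) · U(H)(L⁺)` is dense in `U(H)(𝔸_{L⁺})`** (CM field `L`, `H` non-degenerate hermitian), hypothesis-free
(★ `dense_finiteAdelic_mul_arithmeticSubgroup_of_denseRange` with `hWA := denseRange_archPart_toAdelic_cm`). [cite: PlatonovRapinchuk1994, §7.1 Thm 7.7] -/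
theorem dense_finiteAdelic_mul_arithmeticSubgroup_cm (hH : (H.map (IsCMField.complexConj L))ᵀ = H) (hdet : IsUnit H.det) :
    Dense ((finiteAdelic (↥(maximalRealSubfield L)) L (IsCMField.complexConj L) N H :
        Set (adelicGroupData (↥(maximalRealSubfield L)) L (IsCMField.complexConj L) N H).Adelic) *
      ((adelicGroupData (↥(maximalRealSubfield L)) L (IsCMField.complexConj L) N H).arithmeticSubgroup :
        Set (adelicGroupData (↥(maximalRealSubfield L)) L (IsCMField.complexConj L) N H).Adelic)) :=
  dense_finiteAdelic_mul_arithmeticSubgroup_of_denseRange _ L _ N H (denseRange_archPart_toAdelic_cm N L H hH hdet)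

/-- **`U(H)(𝔸_{L⁺,f}) · (A_G · U(H)(L⁺))` is dense in `U(H)(𝔸_{L⁺})`** (CM, `H` non-degenerate hermitian; `A_G = 1`), hypothesis-free — the `hd` binder of
★ `AdelicGroupData.ergodicSMul_subgroup_automorphicQuotient` for `M := finiteAdelic L⁺ L c̄ N H`, VERBATIM. [cite: PlatonovRapinchuk1994, §7.1 Thm 7.7] -/
theorem dense_finiteAdelic_mul_quotientSubgroup_cm (hH : (H.map (IsCMField.complexConj L))ᵀ = H) (hdet : IsUnit H.det) :
    Dense ((finiteAdelic (↥(maximalRealSubfield L)) L (IsCMField.complexConj L) N H :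
        Set (adelicGroupData (↥(maximalRealSubfield L)) L (IsCMField.complexConj L) N H).Adelic) *
      ((adelicGroupData (↥(maximalRealSubfield L)) L (IsCMField.complexConj L) N H).quotientSubgroup :
        Set (adelicGroupData (↥(maximalRealSubfield L)) L (IsCMField.complexConj L) N H).Adelic)) :=
  dense_finiteAdelic_mul_quotientSubgroup_of_denseRange _ L _ N H (denseRange_archPart_toAdelic_cm N L H hH hdet)

/-! ## §3 The CM case: `L²` consequences hypothesis-free -/

variable (μ : Measure (adelicGroupData (↥(maximalRealSubfield L)) L (IsCMField.complexConj L) N H).automorphicQuotient)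
  [(adelicGroupData (↥(maximalRealSubfield L)) L (IsCMField.complexConj L) N H).IsAutomorphicMeasure μ]

/-- **`U(H)(𝔸_{L⁺,f})` acts ergodically on `U(H)(L⁺) \ U(H)(𝔸_{L⁺})`** (CM, `H` non-degenerate hermitian; any automorphic measure), hypothesis-free
(★ `ergodicSMul_finiteAdelic_automorphicQuotient` with `hWA` discharged; the topological instances are those of ★ `cmDatum L N H`).
[cite: Zimmer1984, §2.2 Cor. 2.2.3] -/
theorem ergodicSMul_finiteAdelic_automorphicQuotient_cm (hH : (H.map (IsCMField.complexConj L))ᵀ = H) (hdet : IsUnit H.det) :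
    ErgodicSMul (finiteAdelic (↥(maximalRealSubfield L)) L (IsCMField.complexConj L) N H)
      (adelicGroupData (↥(maximalRealSubfield L)) L (IsCMField.complexConj L) N H).automorphicQuotient μ := by
  haveI : LocallyCompactSpace (adelicGroupData (↥(maximalRealSubfield L)) L (IsCMField.complexConj L) N H).Adelic :=
    locallyCompactSpace_cmDatum_Adelic L N H
  haveI : SecondCountableTopology (adelicGroupData (↥(maximalRealSubfield L)) L (IsCMField.complexConj L) N H).Adelic :=
    secondCountableTopology_cmDatum_Adelic L N H
  exact ergodicSMul_finiteAdelic_automorphicQuotient _ L _ N H μ (denseRange_archPart_toAdelic_cm N L H hH hdet)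

/-- **An `L²` automorphic function of `U(H)` fixed by `R(1, g_f)` for every `g_f ∈ U(H)(𝔸_{L⁺,f})` is a.e. constant** (CM, `H` non-degenerate hermitian),
hypothesis-free (★ `ae_eq_const_of_forall_rightRegular_finAdelicToAdelic_apply_eq` with `hWA` discharged). [cite: Zimmer1984, §2.2 Cor. 2.2.3] -/
theorem ae_eq_const_of_forall_rightRegular_finAdelicToAdelic_apply_eq_cm (hH : (H.map (IsCMField.complexConj L))ᵀ = H) (hdet : IsUnit H.det)
    {f : (adelicGroupData (↥(maximalRealSubfield L)) L (IsCMField.complexConj L) N H).L2 μ}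
    (hf : ∀ b : finAdelic (↥(maximalRealSubfield L)) L (IsCMField.complexConj L) N H,
      (adelicGroupData (↥(maximalRealSubfield L)) L (IsCMField.complexConj L) N H).rightRegular μ
        (finAdelicToAdelic (↥(maximalRealSubfield L)) L (IsCMField.complexConj L) N H b) f = f) :
    ∃ a : ℂ, (f : (adelicGroupData (↥(maximalRealSubfield L)) L (IsCMField.complexConj L) N H).automorphicQuotient → ℂ) =ᵐ[μ]
      Function.const _ a := by
  haveI : LocallyCompactSpace (adelicGroupData (↥(maximalRealSubfield L)) L (IsCMField.complexConj L) N H).Adelic :=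
    locallyCompactSpace_cmDatum_Adelic L N H
  haveI : SecondCountableTopology (adelicGroupData (↥(maximalRealSubfield L)) L (IsCMField.complexConj L) N H).Adelic :=
    secondCountableTopology_cmDatum_Adelic L N H
  exact ae_eq_const_of_forall_rightRegular_finAdelicToAdelic_apply_eq _ L _ N H μ (denseRange_archPart_toAdelic_cm N L H hH hdet) hf

/-- **An `L²` automorphic function of `U(H)` with `R(1, g_f) f = ψ(1, g_f)⁻¹ f` for every `g_f ∈ U(H)(𝔸_{L⁺,f})` lies on the LINE of the automorphic
character `ψ`** (CM, `H` non-degenerate hermitian), hypothesis-free (★ `mem_lineSubrep_of_forall_rightRegular_finAdelicToAdelic_apply_eq_smul` with `hWA`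
discharged). [cite: Zimmer1984, §2.2 Cor. 2.2.3] -/
theorem mem_lineSubrep_of_forall_rightRegular_finAdelicToAdelic_apply_eq_smul_cm (hH : (H.map (IsCMField.complexConj L))ᵀ = H) (hdet : IsUnit H.det)
    (ψ : (adelicGroupData (↥(maximalRealSubfield L)) L (IsCMField.complexConj L) N H).AutomorphicCharacter)
    {f : (adelicGroupData (↥(maximalRealSubfield L)) L (IsCMField.complexConj L) N H).L2 μ}
    (hf : ∀ b : finAdelic (↥(maximalRealSubfield L)) L (IsCMField.complexConj L) N H,
      (adelicGroupData (↥(maximalRealSubfield L)) L (IsCMField.complexConj L) N H).rightRegular μ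
        (finAdelicToAdelic (↥(maximalRealSubfield L)) L (IsCMField.complexConj L) N H b) f =
        ((ψ (finAdelicToAdelic (↥(maximalRealSubfield L)) L (IsCMField.complexConj L) N H b) : ℂˣ) : ℂ)⁻¹ • f) :
    f ∈ ψ.lineSubrep μ := by
  haveI : LocallyCompactSpace (adelicGroupData (↥(maximalRealSubfield L)) L (IsCMField.complexConj L) N H).Adelic :=
    locallyCompactSpace_cmDatum_Adelic L N H
  haveI : SecondCountableTopology (adelicGroupData (↥(maximalRealSubfield L)) L (IsCMField.complexConj L) N H).Adelic :=
    secondCountableTopology_cmDatum_Adelic L N H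
  exact mem_lineSubrep_of_forall_rightRegular_finAdelicToAdelic_apply_eq_smul _ L _ N H μ (denseRange_archPart_toAdelic_cm N L H hH hdet) ψ hf

/-- **A discrete automorphic representation of `U(H)` on which `U(H)(𝔸_{L⁺,f})` acts by the scalars `ψ(1, g_f)⁻¹` IS the line `ofChar ψ μ`** (CM field `L`,
`H` non-degenerate hermitian, `ψ` an automorphic character), hypothesis-free — ★ `eq_ofChar_of_forall_finAdelicToAdelic_apply_eq_smul` with the
weak-approximation hypothesis `hWA` DISCHARGED by ★ `denseRange_rationalToArch_cm`; in particular ALL of `U(H)(𝔸_{L⁺})` then acts by `ψ⁻¹`.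
On line LH7 this closes residual (iii) «archimedean places» of the O8b census. [cite: Zimmer1984, §2.2 Cor. 2.2.3] [cite: PlatonovRapinchuk1994, §7.1 Thm 7.7] -/
theorem eq_ofChar_of_forall_finAdelicToAdelic_apply_eq_smul_cm (hH : (H.map (IsCMField.complexConj L))ᵀ = H) (hdet : IsUnit H.det)
    (P : DiscreteAutomorphicRep (adelicGroupData (↥(maximalRealSubfield L)) L (IsCMField.complexConj L) N H) μ)
    (ψ : (adelicGroupData (↥(maximalRealSubfield L)) L (IsCMField.complexConj L) N H).AutomorphicCharacter)
    (hP : ∀ (b : finAdelic (↥(maximalRealSubfield L)) L (IsCMField.complexConj L) N H) (v : P.space.toSubmodule),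
      P.space.toContRep (finAdelicToAdelic (↥(maximalRealSubfield L)) L (IsCMField.complexConj L) N H b) v =
        ((ψ (finAdelicToAdelic (↥(maximalRealSubfield L)) L (IsCMField.complexConj L) N H b) : ℂˣ) : ℂ)⁻¹ • v) :
    P = DiscreteAutomorphicRep.ofChar ψ μ := by
  haveI : LocallyCompactSpace (adelicGroupData (↥(maximalRealSubfield L)) L (IsCMField.complexConj L) N H).Adelic :=
    locallyCompactSpace_cmDatum_Adelic L N H
  haveI : SecondCountableTopology (adelicGroupData (↥(maximalRealSubfield L)) L (IsCMField.complexConj L) N H).Adelic :=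
    secondCountableTopology_cmDatum_Adelic L N H
  exact eq_ofChar_of_forall_finAdelicToAdelic_apply_eq_smul _ L _ N H μ (denseRange_archPart_toAdelic_cm N L H hH hdet) P ψ hP

/-- **Two discrete automorphic representations of `U(H)` on which `U(H)(𝔸_{L⁺,f})` acts by the same scalars `ψ(1, g_f)⁻¹` COINCIDE** (CM, `H` non-degenerate
hermitian), hypothesis-free. [cite: Zimmer1984, §2.2 Cor. 2.2.3] -/
theorem eq_of_forall_finAdelicToAdelic_apply_eq_smul_cm (hH : (H.map (IsCMField.complexConj L))ᵀ = H) (hdet : IsUnit H.det)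
    (P P' : DiscreteAutomorphicRep (adelicGroupData (↥(maximalRealSubfield L)) L (IsCMField.complexConj L) N H) μ)
    (ψ : (adelicGroupData (↥(maximalRealSubfield L)) L (IsCMField.complexConj L) N H).AutomorphicCharacter)
    (hP : ∀ (b : finAdelic (↥(maximalRealSubfield L)) L (IsCMField.complexConj L) N H) (v : P.space.toSubmodule),
      P.space.toContRep (finAdelicToAdelic (↥(maximalRealSubfield L)) L (IsCMField.complexConj L) N H b) v =
        ((ψ (finAdelicToAdelic (↥(maximalRealSubfield L)) L (IsCMField.complexConj L) N H b) : ℂˣ) : ℂ)⁻¹ • v)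
    (hP' : ∀ (b : finAdelic (↥(maximalRealSubfield L)) L (IsCMField.complexConj L) N H) (v : P'.space.toSubmodule),
      P'.space.toContRep (finAdelicToAdelic (↥(maximalRealSubfield L)) L (IsCMField.complexConj L) N H b) v =
        ((ψ (finAdelicToAdelic (↥(maximalRealSubfield L)) L (IsCMField.complexConj L) N H b) : ℂˣ) : ℂ)⁻¹ • v) :
    P = P' := by
  rw [eq_ofChar_of_forall_finAdelicToAdelic_apply_eq_smul_cm N L H μ hH hdet P ψ hP,
    eq_ofChar_of_forall_finAdelicToAdelic_apply_eq_smul_cm N L H μ hH hdet P' ψ hP']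

/-- **A discrete automorphic representation of `U(H)` on which `U(H)(𝔸_{L⁺,f})` acts by scalars `ψ(1, g_f)⁻¹` is ONE-DIMENSIONAL** (CM, `H` non-degenerate
hermitian), hypothesis-free. [cite: Zimmer1984, §2.2 Cor. 2.2.3] -/
theorem isOneDimensional_of_forall_finAdelicToAdelic_apply_eq_smul_cm (hH : (H.map (IsCMField.complexConj L))ᵀ = H) (hdet : IsUnit H.det)
    (P : DiscreteAutomorphicRep (adelicGroupData (↥(maximalRealSubfield L)) L (IsCMField.complexConj L) N H) μ)
    (ψ : (adelicGroupData (↥(maximalRealSubfield L)) L (IsCMField.complexConj L) N H).AutomorphicCharacter)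
    (hP : ∀ (b : finAdelic (↥(maximalRealSubfield L)) L (IsCMField.complexConj L) N H) (v : P.space.toSubmodule),
      P.space.toContRep (finAdelicToAdelic (↥(maximalRealSubfield L)) L (IsCMField.complexConj L) N H b) v =
        ((ψ (finAdelicToAdelic (↥(maximalRealSubfield L)) L (IsCMField.complexConj L) N H b) : ℂˣ) : ℂ)⁻¹ • v) :
    P.IsOneDimensional := by
  rw [eq_ofChar_of_forall_finAdelicToAdelic_apply_eq_smul_cm N L H μ hH hdet P ψ hP]
  exact DiscreteAutomorphicRep.isOneDimensional_ofChar ψ μ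

end CM

/-! ## §4 Mok's quasi-split form `Φ_N = antidiag(1, …, 1)`: everything binder-free -/

section AntidiagOne

variable (L : Type) [Field L] [NumberField L] [IsCMField L] (N : ℕ)

/-- `Φ_N = antidiag(1, …, 1)` is hermitian for the CM conjugation: `(c̄ Φ_N)ᵀ = Φ_N` (entries `0, 1`; ★ `antidiagOne_eq_over`, ★ `StdForm.over_map`,
★ `StdForm.transpose_over`). [cite: Mok2014, §1 Notation p. 5] -/
theorem antidiagOne_map_complexConj_transpose :
    ((Matrix.of fun i j : Fin N => if i.val + j.val + 1 = N then (1 : L) else 0).map (IsCMField.complexConj L))ᵀ =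
      Matrix.of fun i j : Fin N => if i.val + j.val + 1 = N then (1 : L) else 0 := by
  rw [antidiagOne_eq_over]
  exact (congrArg Matrix.transpose (StdForm.over_map (StdForm.antidiagonal N) (IsCMField.complexConj L : L →+* L))).trans
    (StdForm.transpose_over _ _)

/-- **Weak approximation at `∞` for `U(Φ_N)`, binder-free** (`archPart ∘ toAdelic` spelling): `γ ↦ (γ)_∞ : U(Φ_N)(L⁺) → U(Φ_N)(L ⊗ ℝ)` has dense range for
Mok's quasi-split `Φ_N` over a CM field `L`. [cite: PlatonovRapinchuk1994, §7.1 Thm 7.7] -/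
theorem denseRange_archPart_toAdelic_antidiagOne :
    DenseRange fun γ : (adelicGroupData (↥(maximalRealSubfield L)) L (IsCMField.complexConj L) N
        (Matrix.of fun i j : Fin N => if i.val + j.val + 1 = N then (1 : L) else 0)).Rational =>
      archPart (↥(maximalRealSubfield L)) L (IsCMField.complexConj L) N
        (Matrix.of fun i j : Fin N => if i.val + j.val + 1 = N then (1 : L) else 0)
        ((adelicGroupData (↥(maximalRealSubfield L)) L (IsCMField.complexConj L) N
          (Matrix.of fun i j : Fin N => if i.val + j.val + 1 = N then (1 : L) else 0)).toAdelic γ) :=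
  denseRange_archPart_toAdelic_cm N L _ (antidiagOne_map_complexConj_transpose L N) (isUnit_antidiagOne_det L N)

/-- **Weak approximation at `∞` for `U(Φ_N)`, binder-free** (★ `rationalToArch` spelling): `U(Φ_N)(L⁺)` is dense in `U(Φ_N)(L ⊗ ℝ)`.
[cite: PlatonovRapinchuk1994, §7.1 Thm 7.7] -/
theorem denseRange_rationalToArch_antidiagOne :
    DenseRange (rationalToArch (↥(maximalRealSubfield L)) L (IsCMField.complexConj L) N
      (Matrix.of fun i j : Fin N => if i.val + j.val + 1 = N then (1 : L) else 0)) :=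
  denseRange_rationalToArch_cm N L _ (antidiagOne_map_complexConj_transpose L N) (isUnit_antidiagOne_det L N)

/-- **`U(Φ_N)(𝔸_{L⁺,f}) · (A_G · U(Φ_N)(L⁺))` is dense in `U(Φ_N)(𝔸_{L⁺})`, binder-free** — the `hd` binder of ★ Moore's lemma for `M := finiteAdelic` on
`adelicGroupData L⁺ L c̄ N Φ_N`. [cite: PlatonovRapinchuk1994, §7.1 Thm 7.7] -/
theorem dense_finiteAdelic_mul_quotientSubgroup_antidiagOne :
    Dense ((finiteAdelic (↥(maximalRealSubfield L)) L (IsCMField.complexConj L) N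
          (Matrix.of fun i j : Fin N => if i.val + j.val + 1 = N then (1 : L) else 0) :
        Set (adelicGroupData (↥(maximalRealSubfield L)) L (IsCMField.complexConj L) N
          (Matrix.of fun i j : Fin N => if i.val + j.val + 1 = N then (1 : L) else 0)).Adelic) *
      ((adelicGroupData (↥(maximalRealSubfield L)) L (IsCMField.complexConj L) N
          (Matrix.of fun i j : Fin N => if i.val + j.val + 1 = N then (1 : L) else 0)).quotientSubgroup :
        Set (adelicGroupData (↥(maximalRealSubfield L)) L (IsCMField.complexConj L) N
          (Matrix.of fun i j : Fin N => if i.val + j.val + 1 = N then (1 : L) else 0)).Adelic)) :=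
  dense_finiteAdelic_mul_quotientSubgroup_cm N L _ (antidiagOne_map_complexConj_transpose L N) (isUnit_antidiagOne_det L N)

variable (μ : Measure (adelicGroupData (↥(maximalRealSubfield L)) L (IsCMField.complexConj L) N
    (Matrix.of fun i j : Fin N => if i.val + j.val + 1 = N then (1 : L) else 0)).automorphicQuotient)
  [(adelicGroupData (↥(maximalRealSubfield L)) L (IsCMField.complexConj L) N
    (Matrix.of fun i j : Fin N => if i.val + j.val + 1 = N then (1 : L) else 0)).IsAutomorphicMeasure μ]

/-- **`U(Φ_N)(𝔸_{L⁺,f})` acts ergodically on `U(Φ_N)(L⁺) \ U(Φ_N)(𝔸_{L⁺})`, binder-free** (any automorphic measure). [cite: Zimmer1984, §2.2 Cor. 2.2.3] -/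
theorem ergodicSMul_finiteAdelic_automorphicQuotient_antidiagOne :
    ErgodicSMul (finiteAdelic (↥(maximalRealSubfield L)) L (IsCMField.complexConj L) N
        (Matrix.of fun i j : Fin N => if i.val + j.val + 1 = N then (1 : L) else 0))
      (adelicGroupData (↥(maximalRealSubfield L)) L (IsCMField.complexConj L) N
        (Matrix.of fun i j : Fin N => if i.val + j.val + 1 = N then (1 : L) else 0)).automorphicQuotient μ :=
  ergodicSMul_finiteAdelic_automorphicQuotient_cm N L _ μ (antidiagOne_map_complexConj_transpose L N) (isUnit_antidiagOne_det L N)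

/-- **A discrete automorphic representation of `U(Φ_N)` on which `U(Φ_N)(𝔸_{L⁺,f})` acts by the scalars `ψ(1, g_f)⁻¹` IS `ofChar ψ μ`, binder-free** — at
`N = 2`, with `ψ := ((η ψ) ∘ det)⁻¹` (★ `cmDetChar`) and the finite-adelic scalars from ★ `DiscreteAutomorphicRepFinAdelicScalar` ∘ ★ `F0P3cPKtupleU2LocalIsotypyFull`,
this is the O8b close «`P₂ = ofChar ((η ψ) ∘ det)⁻¹ μ₂`» with NO archimedean hypothesis. [cite: Zimmer1984, §2.2 Cor. 2.2.3] [cite: PlatonovRapinchuk1994, §7.1 Thm 7.7] -/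
theorem eq_ofChar_of_forall_finAdelicToAdelic_apply_eq_smul_antidiagOne
    (P : DiscreteAutomorphicRep (adelicGroupData (↥(maximalRealSubfield L)) L (IsCMField.complexConj L) N
      (Matrix.of fun i j : Fin N => if i.val + j.val + 1 = N then (1 : L) else 0)) μ)
    (ψ : (adelicGroupData (↥(maximalRealSubfield L)) L (IsCMField.complexConj L) N
      (Matrix.of fun i j : Fin N => if i.val + j.val + 1 = N then (1 : L) else 0)).AutomorphicCharacter)
    (hP : ∀ (b : finAdelic (↥(maximalRealSubfield L)) L (IsCMField.complexConj L) N
        (Matrix.of fun i j : Fin N => if i.val + j.val + 1 = N then (1 : L) else 0)) (v : P.space.toSubmodule),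
      P.space.toContRep (finAdelicToAdelic (↥(maximalRealSubfield L)) L (IsCMField.complexConj L) N
          (Matrix.of fun i j : Fin N => if i.val + j.val + 1 = N then (1 : L) else 0) b) v =
        ((ψ (finAdelicToAdelic (↥(maximalRealSubfield L)) L (IsCMField.complexConj L) N
          (Matrix.of fun i j : Fin N => if i.val + j.val + 1 = N then (1 : L) else 0) b) : ℂˣ) : ℂ)⁻¹ • v) :
    P = DiscreteAutomorphicRep.ofChar ψ μ :=
  eq_ofChar_of_forall_finAdelicToAdelic_apply_eq_smul_cm N L _ μ (antidiagOne_map_complexConj_transpose L N) (isUnit_antidiagOne_det L N) P ψ hP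

/-- **Two discrete automorphic representations of `U(Φ_N)` on which `U(Φ_N)(𝔸_{L⁺,f})` acts by the same scalars `ψ(1, g_f)⁻¹` coincide, binder-free.**
[cite: Zimmer1984, §2.2 Cor. 2.2.3] -/
theorem eq_of_forall_finAdelicToAdelic_apply_eq_smul_antidiagOne
    (P P' : DiscreteAutomorphicRep (adelicGroupData (↥(maximalRealSubfield L)) L (IsCMField.complexConj L) N
      (Matrix.of fun i j : Fin N => if i.val + j.val + 1 = N then (1 : L) else 0)) μ)
    (ψ : (adelicGroupData (↥(maximalRealSubfield L)) L (IsCMField.complexConj L) N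
      (Matrix.of fun i j : Fin N => if i.val + j.val + 1 = N then (1 : L) else 0)).AutomorphicCharacter)
    (hP : ∀ (b : finAdelic (↥(maximalRealSubfield L)) L (IsCMField.complexConj L) N
        (Matrix.of fun i j : Fin N => if i.val + j.val + 1 = N then (1 : L) else 0)) (v : P.space.toSubmodule),
      P.space.toContRep (finAdelicToAdelic (↥(maximalRealSubfield L)) L (IsCMField.complexConj L) N
          (Matrix.of fun i j : Fin N => if i.val + j.val + 1 = N then (1 : L) else 0) b) v =
        ((ψ (finAdelicToAdelic (↥(maximalRealSubfield L)) L (IsCMField.complexConj L) N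
          (Matrix.of fun i j : Fin N => if i.val + j.val + 1 = N then (1 : L) else 0) b) : ℂˣ) : ℂ)⁻¹ • v)
    (hP' : ∀ (b : finAdelic (↥(maximalRealSubfield L)) L (IsCMField.complexConj L) N
        (Matrix.of fun i j : Fin N => if i.val + j.val + 1 = N then (1 : L) else 0)) (v : P'.space.toSubmodule),
      P'.space.toContRep (finAdelicToAdelic (↥(maximalRealSubfield L)) L (IsCMField.complexConj L) N
          (Matrix.of fun i j : Fin N => if i.val + j.val + 1 = N then (1 : L) else 0) b) v =
        ((ψ (finAdelicToAdelic (↥(maximalRealSubfield L)) L (IsCMField.complexConj L) N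
          (Matrix.of fun i j : Fin N => if i.val + j.val + 1 = N then (1 : L) else 0) b) : ℂˣ) : ℂ)⁻¹ • v) :
    P = P' :=
  eq_of_forall_finAdelicToAdelic_apply_eq_smul_cm N L _ μ (antidiagOne_map_complexConj_transpose L N) (isUnit_antidiagOne_det L N) P P' ψ hP hP'

/-- **A discrete automorphic representation of `U(Φ_N)` on which `U(Φ_N)(𝔸_{L⁺,f})` acts by scalars `ψ(1, g_f)⁻¹` is one-dimensional, binder-free.**
[cite: Zimmer1984, §2.2 Cor. 2.2.3] -/
theorem isOneDimensional_of_forall_finAdelicToAdelic_apply_eq_smul_antidiagOne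
    (P : DiscreteAutomorphicRep (adelicGroupData (↥(maximalRealSubfield L)) L (IsCMField.complexConj L) N
      (Matrix.of fun i j : Fin N => if i.val + j.val + 1 = N then (1 : L) else 0)) μ)
    (ψ : (adelicGroupData (↥(maximalRealSubfield L)) L (IsCMField.complexConj L) N
      (Matrix.of fun i j : Fin N => if i.val + j.val + 1 = N then (1 : L) else 0)).AutomorphicCharacter)
    (hP : ∀ (b : finAdelic (↥(maximalRealSubfield L)) L (IsCMField.complexConj L) N
        (Matrix.of fun i j : Fin N => if i.val + j.val + 1 = N then (1 : L) else 0)) (v : P.space.toSubmodule),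
      P.space.toContRep (finAdelicToAdelic (↥(maximalRealSubfield L)) L (IsCMField.complexConj L) N
          (Matrix.of fun i j : Fin N => if i.val + j.val + 1 = N then (1 : L) else 0) b) v =
        ((ψ (finAdelicToAdelic (↥(maximalRealSubfield L)) L (IsCMField.complexConj L) N
          (Matrix.of fun i j : Fin N => if i.val + j.val + 1 = N then (1 : L) else 0) b) : ℂˣ) : ℂ)⁻¹ • v) :
    P.IsOneDimensional :=
  isOneDimensional_of_forall_finAdelicToAdelic_apply_eq_smul_cm N L _ μ (antidiagOne_map_complexConj_transpose L N) (isUnit_antidiagOne_det L N) P ψ hP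

end AntidiagOne

end UnitaryGroup

end Literature.NumberTheory.Automorphic

end
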